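import Summits.BirchSwinnertonDyer.BirchSwinnertonDyer.Theorems.EisensteinDepletionAtTwoStarOptBSFSigmaNodeCuspPrelims
import Summits.BirchSwinnertonDyer.BirchSwinnertonDyer.Theorems.EisensteinDepletionAtTwoStarOptBSFSigmaNodeMid
import Summits.BirchSwinnertonDyer.BirchSwinnertonDyer.Theorems.EisensteinDepletionAtTwoStarOptBNSFParityGroup
import Summits.BirchSwinnertonDyer.BirchSwinnertonDyer.Theorems.ManinLocalTwoThreeVeluTwoIsogenous
import Literature.NumberTheory.EllipticCurves.LatticeIndexTwoHalfPeriodProofs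
import Literature.NumberTheory.EllipticCurves.CanonicalPAdicHeight
import Literature.NumberTheory.EllipticCurves.TwoAdicImageGoodOrdinaryAtTwoProofs
import Literature.NumberTheory.EllipticCurves.BSDSelmerCMPConverseMaximalOrderProofs
import Literature.NumberTheory.EllipticCurves.IsogenyDualProofs
import Literature.NumberTheory.EllipticCurves.ModularCurveManinSemistableBridgeProofs
import Literature.NumberTheory.EllipticCurves.ManinConstantIntegral
import Literature.NumberTheory.EllipticCurves.Gamma1ParametrizationCuspIdentityComponent
import HarnessLib

/-!
# Line `star` on crux E1M (stmt-BirchSwinnertonDyer-20341): THE NODE LAW (N256) AT EVERY LEVEL from the printed fact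
# «images of the cusps over `∞` under an `X₁(N)`-parametrisation reduce into the identity component» (CES 2003 §6.1.2 + Igusa + ATAEC IV.9)

Lead star-p1 GEN 18.  Lines/star.lean v12 (GEN 17) left ONE research stub, the node law `stub_sigmaNodeCompositeOr17` («the formal
Shimura-type rational 2-torsion point `P` of the `X₀(N)`-lattice-optimal `W₀` has complementary discriminant `α² − 32β = ±2⁸`»,
`α = b₂ + 12x`, `β = b₄ + x b₂ + 6x²`), sourced to the connectedness of the fibres of `J₁(N)` (Conrad–Edixhoven–Stein 2003, prime level only).
THIS FILE derives the node law AT EVERY LEVEL from a much weaker printed input, the named fact (hypothesis `hF`, stated inline; filed for the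
Literature as `gamma1Parametrization_cuspImage_nonsingularReduction`, Literature/NumberTheory/EllipticCurves/Gamma1ParametrizationCuspIdentityComponent.lean):
  (F) for a globally minimal `E/ℚ` with newform `f`, Néron lattice `Λ_E`, an integer `c ≠ 0` with `cΛ₁(f) ⊆ Λ_E`, and `γ ∈ Γ₀(N)` with
      `z = c{∞, γ∞}_f ∉ Λ_E`, the point `(℘(z) − b₂/12, (℘′(z) − a₁x − a₃)/2)` of `E` is RATIONAL and reduces NON-SINGULARLY mod every prime
      [`X_μ(N)` is a smooth `ℤ`-curve whose `ℤ`-points `⟨d⟩∞` are the cusps over `∞` (CES 2003 §6.1.2); Néron mapping property; the fibre at `p`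
      is the connected Igusa curve (Katz–Mazur 12.6); identity component = non-singular locus (ATAEC IV.9.1)].
THE DERIVATION (`sigmaNode_of_cuspImageNonsingular`; `z₀ = λ/2` the half-period of `P`, `e₀ = ℘(z₀) = x + b₂/12`).  (1) The Kummer parity
`c₀Λ₁(f) ⊆ ℤλ + 2Λ₀` extends from generators to `Λ₁(f)`, and some `μ = c₀{∞, γ∞}_f ∈ Λ₀ = c₀Λ_f` lies OUTSIDE `ℤλ + 2Λ₀`
(`ParityGroup.exists_mem_lattice_not_half`).  (2) By `ManinLocalTwoThree.exists_isIsogenous_dvd_two_velu_two` there is a globally minimal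
`W′ ∼ W₀` with `k⁴c₄(W′) = 720e₀² − 4c₄`, `k ∣ 2`, and `ord₂Δ(W′) + 3 ord₂(β/2) + 12 ord₂ k = 2 ord₂ Δ(W₀)`; `P` formal (`x = ξ/4`, `ξ` odd,
`ord₂ β = −3`) and both curves good at `2` force `k = ±2`, so by Vélu on the analytic side (`PeriodPair.lattice_eq_of_velu_invariants`) the Néron
lattice of `W′` is `Λ′ = 2Λ₀ + ℤλ ⊇ c₀Λ₁(f)`, `μ ∉ Λ′`, `2μ ∈ Λ′`.  (3) (F) for `(W′, f, Λ′, c₀, γ)` gives a rational 2-torsion point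
`T̄ = (x′, y′)` of `W′`, non-singular mod every prime; `℘_{Λ₀+ℤz₀}(μ/2) = −2e₀` (Prelims: `weierstrassP_velu_otherHalfPeriod`) gives
`x′ = −e₀/2 − b₂(W′)/12` and `Φ_x(T̄) = −(α² − 32β)/256`.  (4) At an odd prime, non-singularity of a 2-torsion point means `ord_p Φ_x(T̄) = 0`
(`Φ_y = 0`, `4x′ ∈ ℤ`), so `α² − 32β` has no odd prime factor; `4Δ = β²(α² − 32β)` with `Δ`, `8β` odd pins `±256` (Prelims: `int_eq_pm_256`).

CONDITIONAL on (F) (hypothesis `hF`, a print) and Edixhoven's integrality of the `X₀(N)`-constant (`hEd`, a print); no `sorry`, no definition;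
nothing here reads `r_an`; E1M / BSD are NOT proved by this file (E1M becomes a tree theorem modulo SEVEN prints through Lines/star.lean v13).
-/

set_option linter.dupNamespace false
set_option autoImplicit false

noncomputable section

open scoped Classical MatrixGroups PeriodPair
open CongruenceSubgroup Polynomial
open WeierstrassCurve Literature.NumberTheory.EllipticCurves Literature.NumberTheory.EllipticCurves.Greenberg1999
open Literature.NumberTheory.EllipticCurves.ModularForms

namespace Summit.BirchSwinnertonDyer.BirchSwinnertonDyer.Theorems.DepletionAtTwo.SigmaNode

/-! ### The node law (N256) at every level from (F) -/

/-- **THE NODE LAW (N256) AT EVERY LEVEL — v10/v11's research stub `stub_sigmaNode` VERBATIM (hence v12's `stub_sigmaNodeCompositeOr17`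
a fortiori) from the printed fact (F) `gamma1Parametrization_cuspImage_nonsingularReduction` (hypothesis `hF`, stated inline: CES 2003 §6.1.2
smooth `ℤ`-model `X_μ(N)` → Néron model, Katz–Mazur 12.6 connected Igusa fibre, ATAEC IV.9.1 identity component = non-singular locus) and
Edixhoven's integrality of the lattice-optimal `X₀(N)`-constant (hypothesis `hEd`).**  Route (module docstring): the Kummer-parity hypothesis
puts `c₀Λ₁(f)` inside the Néron lattice `2Λ₀ + ℤλ` of the globally minimal 2-isogenous partner `W′ = W₀/P`
(`ManinLocalTwoThree.exists_isIsogenous_dvd_two_velu_two`, `PeriodPair.lattice_eq_of_velu_invariants`, `k = ±2` by the 2-adic count for a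
formal `P`); the image of a cusp `γ∞` with `c₀{∞,γ∞}_f ∉ 2Λ₀ + ℤλ` is the dual-kernel 2-torsion point `T̄` of `W′`
(`weierstrassP_velu_otherHalfPeriod`: `℘`-value `−2e₀`), whose `Φ_x(T̄) = −(α² − 32β)/256`; (F) makes `Φ_x(T̄)` a `p`-unit at every odd
prime; `4Δ = β²(α² − 32β)` with `Δ`, `8β` odd finishes (`int_eq_pm_256`).  CONDITIONAL on the two prints.
[cite: ConradEdixhovenStein2003, §6.1.2 proof of Lemma 6.1.6 (p. 381)] [cite: KatzMazur1985, Thm. 12.6.1 and Cor. 12.6.2]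
[cite: SilvermanATAEC1994, IV.9 Cor. 9.1] [cite: Edixhoven1991, Prop. 2] [cite: SilvermanAEC2009, III.4 Example 4.5] -/
theorem sigmaNode_of_cuspImageNonsingular (hF : gamma1Parametrization_cuspImage_nonsingularReduction)
    (hEd : edixhoven_optimalManinConstant_integral) :
    ∀ (W₀ : WeierstrassCurve ℚ) [W₀.IsElliptic] [W₀.IsGloballyMinimal]
      ⦃N : ℕ⦄ [NeZero N] (f : CuspForm (Gamma0 N) 2), IsNewformOf W₀ f → IsOrdinaryAt W₀ 2 →
      ∀ (L₀ : PeriodPair), IsNeronLatticeOf (W₀.baseChange ℂ) L₀ → ∀ (q : ℚ), q ≠ 0 →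
      (∀ z ∈ periodLattice f, (q : ℂ) * z ∈ L₀.lattice) → (∀ z ∈ L₀.lattice, ∃ w ∈ periodLattice f, z = (q : ℂ) * w) →
      ∀ (x : ℚ), HasRationalTwoTorsionX W₀ x → TwoTorsionRamifiedAtTwo x →
      ∀ (lam : ℂ), lam ∈ L₀.lattice → lam / 2 ∉ L₀.lattice →
        L₀.weierstrassP (lam / 2) - ((W₀.b₂ : ℚ) : ℂ) / 12 = ((x : ℚ) : ℂ) →
      (∀ (γ : SL(2, ℤ)) (hγ : γ ∈ Gamma0 N), γ ∈ Gamma1 N →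
        ∃ k : ℤ, ∃ w ∈ L₀.lattice, (q : ℂ) * cuspSymbol f ⟨γ, hγ⟩ = (k : ℂ) * lam + 2 * w) →
      (W₀.b₂ + 12 * x) ^ 2 - 32 * (W₀.b₄ + x * W₀.b₂ + 6 * x ^ 2) = 256 ∨
        (W₀.b₂ + 12 * x) ^ 2 - 32 * (W₀.b₄ + x * W₀.b₂ + 6 * x ^ 2) = -256 := by
  intro W₀ _ _ N _ f hW₀ hord L₀ hL₀ q hq hin hout x hx hram lam hlam hlam2 hwp hpar
  -- ### (0) bookkeeping on `W₀`: `q ∈ ℤ` (Edixhoven), `b₂, b₄ ∈ ℤ`, `x = ξ/4` with `ξ` odd, `Δ` odd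
  obtain ⟨qz, hqz⟩ := hEd hW₀ hL₀ q hin hout
  have hgood : W₀.HasGoodReductionAtPrime 2 := hord.1
  obtain ⟨B₂, B₄, ξ, hB₂, hB₄, hξ, hξodd⟩ := exists_int_b₂_b₄_xi W₀ hgood hx hram
  have hxξ : x = (ξ : ℚ) / 4 := by rw [hξ]; ring
  have hΔodd : Odd (WeierstrassCurve.integralModelInt W₀).Δ := odd_Δ_integralModelInt_of_good_two W₀ hgood
  have hΔcast : ((WeierstrassCurve.integralModelInt W₀).Δ : ℚ) = W₀.Δ := WeierstrassCurve.cast_minimalDiscriminantInt W₀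
  -- the complementary discriminant `D` and `β`, as integers
  set D : ℚ := (W₀.b₂ + 12 * x) ^ 2 - 32 * (W₀.b₄ + x * W₀.b₂ + 6 * x ^ 2) with hD
  set Dz : ℤ := (B₂ + 3 * ξ) ^ 2 - 32 * B₄ - 8 * ξ * B₂ - 12 * ξ ^ 2 with hDz
  set βn : ℤ := 8 * B₄ + 2 * ξ * B₂ + 3 * ξ ^ 2 with hβn
  have hDcast : D = (Dz : ℚ) := by rw [hD, hDz, hB₂, hB₄, hxξ]; push_cast; ring
  have hβcast : W₀.b₄ + x * W₀.b₂ + 6 * x ^ 2 = (βn : ℚ) / 8 := by rw [hβn, hB₂, hB₄, hxξ]; push_cast; ring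
  have hβnodd : Odd βn := by
    rw [hβn]
    obtain ⟨m, hm⟩ := hξodd
    exact ⟨4 * B₄ + ξ * B₂ + 6 * m ^ 2 + 6 * m + 1, by rw [hm]; ring⟩
  have h4Δ : 4 * W₀.Δ = (W₀.b₄ + x * W₀.b₂ + 6 * x ^ 2) ^ 2 * D := four_mul_Δ_eq W₀ hx
  rw [hβcast] at h4Δ
  have hrel : βn ^ 2 * Dz = 256 * (WeierstrassCurve.integralModelInt W₀).Δ := by
    have h : ((βn ^ 2 * Dz : ℤ) : ℚ) = ((256 * (WeierstrassCurve.integralModelInt W₀).Δ : ℤ) : ℚ) := by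
      push_cast
      rw [hΔcast, ← hDcast]
      linear_combination (-64 : ℚ) * h4Δ
    exact_mod_cast h
  -- it suffices to see that `D` has no odd prime factor
  suffices hodd : ∀ p : ℕ, p.Prime → p ≠ 2 → ¬ (p : ℤ) ∣ Dz by
    rcases int_eq_pm_256 hβnodd hΔodd hrel hodd with h | h
    · left; rw [hDcast, h]; norm_num
    · right; rw [hDcast, h]; norm_num
  intro p hp hp2
  haveI : Fact p.Prime := ⟨hp⟩
  -- ### (1) a cusp symbol `μ = q{∞,γ∞}_f ∈ Λ₀` outside `ℤλ + 2Λ₀`; the Kummer parity on all of `Λ₁(f)`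
  obtain ⟨γ, hγ, hμnot⟩ : ∃ (γ : SL(2, ℤ)) (hγ : γ ∈ Gamma0 N),
      ¬ ∃ k : ℤ, ∃ w ∈ L₀.lattice, (q : ℂ) * cuspSymbol f ⟨γ, hγ⟩ = (k : ℂ) * lam + 2 * w := by
    by_contra hall
    push Not at hall
    have hgen : ∀ w ∈ periodLattice f, ∃ k : ℤ, ∃ w' ∈ L₀.lattice, (q : ℂ) * w = (k : ℂ) * lam + 2 * w' := by
      intro w hw
      induction hw using AddSubgroup.closure_induction with
      | mem z hz =>
        obtain ⟨γ', rfl⟩ := hz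
        exact hall γ'.1 γ'.2
      | zero => rw [mul_zero]; exact ParityGroup.zero_mem_half L₀ lam
      | add u v hu hv ihu ihv =>
        rw [mul_add]
        exact (KummerStubs.halfLattice_add_iff L₀ hlam hlam2 (hin u hu) (hin v hv)).mpr (iff_of_true ihu ihv)
      | neg u hu ih => rw [mul_neg]; exact ParityGroup.neg_mem_half ih
    obtain ⟨z, hz, hnot⟩ := ParityGroup.exists_mem_lattice_not_half L₀ hlam hlam2
    obtain ⟨w, hw, rfl⟩ := hout z hz
    exact hnot (hgen w hw)
  set μ : ℂ := (q : ℂ) * cuspSymbol f ⟨γ, hγ⟩ with hμdef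
  have hμL₀ : μ ∈ L₀.lattice := hin _ (cuspSymbol_mem_periodLattice f ⟨γ, hγ⟩)
  have hμ2 : μ / 2 ∉ L₀.lattice := by
    intro h; apply hμnot
    exact ⟨0, μ / 2, h, by push_cast; ring⟩
  have hμz : μ / 2 - lam / 2 ∉ L₀.lattice := by
    intro h; apply hμnot
    exact ⟨1, μ / 2 - lam / 2, h, by push_cast; ring⟩
  have hμz' : -(μ / 2) - lam / 2 ∉ L₀.lattice := by
    intro h; apply hμnot
    exact ⟨-1, -(-(μ / 2) - lam / 2), neg_mem h, by push_cast; ring⟩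
  have hparΛ₁ : ∀ w ∈ periodLatticeGamma1 f, ∃ k : ℤ, ∃ w' ∈ L₀.lattice, (q : ℂ) * w = (k : ℂ) * lam + 2 * w' := by
    intro w hw
    induction hw using AddSubgroup.closure_induction with
    | mem z hz =>
      obtain ⟨γ', rfl⟩ := hz
      exact hpar γ'.1 (Gamma1_in_Gamma0 N γ'.2) γ'.2
    | zero => rw [mul_zero]; exact ParityGroup.zero_mem_half L₀ lam
    | add u v hu hv ihu ihv =>
      rw [mul_add]
      exact (KummerStubs.halfLattice_add_iff L₀ hlam hlam2 (hin u (periodLatticeGamma1_le_periodLattice f hu))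
        (hin v (periodLatticeGamma1_le_periodLattice f hv))).mpr (iff_of_true ihu ihv)
    | neg u hu ih => rw [mul_neg]; exact ParityGroup.neg_mem_half ih
  -- ### (2) the 2-isogenous partner `W′` of `W₀` by `P`, globally minimal, and its Néron lattice
  set q' : ℚ := x + W₀.b₂ / 12 with hq'
  have hq'Ψ : W₀.Ψ₂Sq.eval (q' - W₀.b₂ / 12) = 0 := by
    have e : q' - W₀.b₂ / 12 = x := by rw [hq']; ring
    obtain ⟨y, hEq, h2y⟩ := hx
    rw [e]
    simp only [WeierstrassCurve.Ψ₂Sq, eval_add, eval_mul, eval_C, eval_pow, eval_X]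
    linear_combination fourXCubed_add_eq_zero_of_twoTorsion hEq h2y
  obtain ⟨W', k, hW'ell, hW'min, hiso, hk2, hk0, hc4, hc6, hval⟩ :=
    ManinLocalTwoThree.exists_isIsogenous_dvd_two_velu_two W₀ q' hq'Ψ
  haveI := hW'ell
  haveI := hW'min
  haveI : (W'.baseChange ℂ).IsElliptic := by rw [WeierstrassCurve.baseChange]; infer_instance
  obtain ⟨L', hL'⟩ := exists_isNeronLatticeOf_holds (W'.baseChange ℂ)
  have hgood' : W'.HasGoodReductionAtPrime 2 := (hiso.hasGoodReductionAtPrime_iff 2).mp hgood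
  -- `k = ±2` from the valuation law at `2`
  have hB_eq : 3 * q' ^ 2 - W₀.c₄ / 48 = (βn : ℚ) / 16 := by
    rw [hq', WeierstrassCurve.c₄, hβn, hB₂, hB₄, hxξ]; push_cast; ring
  have hβn0 : (βn : ℚ) ≠ 0 := by
    have : βn ≠ 0 := by rintro h0; rw [h0] at hβnodd; exact absurd hβnodd (by decide)
    exact_mod_cast this
  have hk_sq : k = 2 ∨ k = -2 := by
    have hv := hval 2
    have hv0 : padicValInt 2 W₀.minimalDiscriminantInt = 0 :=
      padicValInt.eq_zero_of_not_dvd (not_dvd_minimalDiscriminantInt_of_hasGoodReductionAtPrime' W₀ 2 hgood)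
    have hv0' : padicValInt 2 W'.minimalDiscriminantInt = 0 :=
      padicValInt.eq_zero_of_not_dvd (not_dvd_minimalDiscriminantInt_of_hasGoodReductionAtPrime' W' 2 hgood')
    have hvB : padicValRat 2 (3 * q' ^ 2 - W₀.c₄ / 48) = -4 := by
      rw [hB_eq, padicValRat.div hβn0 (by norm_num), padicValRat.of_int,
        padicValInt.eq_zero_of_not_dvd (fun h ↦ (Int.not_even_iff_odd.mpr hβnodd) (even_iff_two_dvd.mpr h))]
      have : padicValRat 2 (16 : ℚ) = 4 := by
        rw [show (16 : ℚ) = ((2 ^ 4 : ℕ) : ℚ) by norm_num, padicValRat.of_nat, padicValNat.prime_pow]; norm_num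
      rw [this]; norm_num
    rw [hv0, hv0', hvB] at hv
    have hvk : padicValInt 2 k = 1 := by
      have : (12 : ℤ) * (padicValInt 2 k : ℤ) = 12 := by push_cast at hv ⊢; linarith
      omega
    have hkabs : k.natAbs ∣ 2 := by
      have := Int.natAbs_dvd_natAbs.mpr hk2
      simpa using this
    have hk1 : k.natAbs ≠ 1 := by
      intro h1
      rcases Int.natAbs_eq_iff.mp (by rw [h1]; rfl : k.natAbs = (1 : ℤ).natAbs) with rfl | rfl
      · simp [padicValInt] at hvk
      · simp [padicValInt] at hvk
    have hk2' : k.natAbs = 2 := by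
      rcases (Nat.dvd_prime Nat.prime_two).mp hkabs with h | h
      · exact absurd h hk1
      · exact h
    rcases Int.natAbs_eq_iff.mp (by rw [hk2']; rfl : k.natAbs = (2 : ℤ).natAbs) with h | h
    · exact Or.inl h
    · exact Or.inr h
  have hkQ : (k : ℚ) ^ 2 = 4 := by rcases hk_sq with rfl | rfl <;> norm_num
  have hk4 : (k : ℚ) ^ 4 = 16 := by nlinarith [hkQ]
  have hkC : (k : ℂ) ≠ 0 := by exact_mod_cast hk0
  have hkC2 : (k : ℂ) ^ 2 = 4 := by exact_mod_cast hkQ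
  -- the rescaled Néron lattice `Λ'' = k⁻¹Λ'` has the Vélu invariants
  set L'' : PeriodPair := L'.mulLeft ((k : ℂ)⁻¹) (inv_ne_zero hkC) with hL''def
  have hc₄W' : (W'.baseChange ℂ).c₄ = (W'.c₄ : ℂ) := by simp [WeierstrassCurve.baseChange, WeierstrassCurve.map_c₄]
  have hc₆W' : (W'.baseChange ℂ).c₆ = (W'.c₆ : ℂ) := by simp [WeierstrassCurve.baseChange, WeierstrassCurve.map_c₆]
  have hc₄W₀ : (W₀.baseChange ℂ).c₄ = (W₀.c₄ : ℂ) := by simp [WeierstrassCurve.baseChange, WeierstrassCurve.map_c₄]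
  have he₀ : ℘[L₀] (lam / 2) = ((q' : ℚ) : ℂ) := by
    rw [hq']; push_cast; linear_combination hwp
  set Bc : ℂ := 3 * ℘[L₀] (lam / 2) ^ 2 - L₀.g₂ / 4 with hBc
  have hBcval : Bc = (((3 * q' ^ 2 - W₀.c₄ / 48 : ℚ)) : ℂ) := by
    rw [hBc, he₀, hL₀.1, hc₄W₀]; push_cast; ring
  have hBc0 : Bc ≠ 0 := by
    rw [hBcval]; exact_mod_cast ManinLocalTwoThree.velu_two_B_ne_zero W₀ q' hq'Ψ
  have hc4' : W'.c₄ = (720 * q' ^ 2 - 4 * W₀.c₄) / 16 := by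
    rw [← hk4]; field_simp; linear_combination hc4
  have hc6' : W'.c₆ = (19008 * q' ^ 3 - 144 * W₀.c₄ * q') / (k : ℚ) ^ 6 := by
    have hk6 : (k : ℚ) ^ 6 ≠ 0 := pow_ne_zero _ (by exact_mod_cast hk0)
    field_simp; linear_combination hc6
  have h₂ : L''.g₂ = 12 * ℘[L₀] (lam / 2) ^ 2 + 16 * Bc := by
    rw [hL''def, PeriodPair.g₂_mulLeft, hL'.1, hc₄W', hc4', hBcval, he₀, inv_pow, inv_inv]
    push_cast
    have : (k : ℂ) ^ 4 = 16 := by exact_mod_cast hk4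
    rw [this]; ring
  have h₃ : L''.g₃ = -8 * ℘[L₀] (lam / 2) ^ 3 + 32 * Bc * ℘[L₀] (lam / 2) := by
    rw [hL''def, PeriodPair.g₃_mulLeft, hL'.2, hc₆W', hc6', hBcval, he₀, inv_pow, inv_inv]
    have hk6 : ((k : ℚ) : ℂ) ^ 6 ≠ 0 := pow_ne_zero _ (by exact_mod_cast hk0)
    push_cast at hk6 ⊢
    field_simp
    ring
  have hz₀ : lam / 2 ∉ L₀.lattice := hlam2
  have h2z₀ : 2 * (lam / 2) ∈ L₀.lattice := by
    have e : 2 * (lam / 2) = lam := by ring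
    rw [e]; exact hlam
  obtain ⟨hle, hz₀mem, hidx⟩ := L₀.lattice_eq_of_velu_invariants hz₀ h2z₀ hBc hBc0 L'' h₂ h₃
  -- membership dictionary between `Λ'` and `Λ'' = Λ₀ + ℤz₀`
  have hmem'' : ∀ y : ℂ, y ∈ L''.lattice ↔ (k : ℂ) * y ∈ L'.lattice := by
    intro y; rw [hL''def, PeriodPair.mem_mulLeft_lattice, inv_inv]
  have htwo : ∀ w ∈ L''.lattice, 2 * w ∈ L'.lattice := by
    intro w hw
    rcases hk_sq with hk | hk
    · have : (k : ℂ) = 2 := by exact_mod_cast hk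
      rw [← this]; exact (hmem'' w).mp hw
    · have : (k : ℂ) = -2 := by exact_mod_cast hk
      have h := (hmem'' (-w)).mp (neg_mem hw)
      rw [this] at h
      have e : (-2 : ℂ) * -w = 2 * w := by ring
      rwa [e] at h
  have h2L₀ : ∀ w ∈ L₀.lattice, 2 * w ∈ L'.lattice := fun w hw ↦ htwo w (hle hw)
  have hlamL' : lam ∈ L'.lattice := by
    have e : lam = 2 * (lam / 2) := by ring
    rw [e]; exact htwo _ hz₀mem
  have hhalf : ∀ z : ℂ, (∃ k₁ : ℤ, ∃ w ∈ L₀.lattice, z = (k₁ : ℂ) * lam + 2 * w) → z ∈ L'.lattice := by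
    rintro z ⟨k₁, w, hw, rfl⟩
    exact add_mem (by rw [← zsmul_eq_mul]; exact Submodule.smul_of_tower_mem _ k₁ hlamL') (h2L₀ w hw)
  have hμL' : μ ∉ L'.lattice := by
    intro h
    have h' : μ / (k : ℂ) ∈ L''.lattice := (hmem'' _).mpr (by rwa [mul_div_cancel₀ _ hkC])
    rcases hk_sq with hk | hk
    · have hk' : (k : ℂ) = 2 := by exact_mod_cast hk
      rw [hk'] at h'
      rcases hidx _ h' with h1 | h1
      · exact hμ2 h1
      · exact hμz h1
    · have hk' : (k : ℂ) = -2 := by exact_mod_cast hk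
      rw [hk'] at h'
      have e : μ / (-2 : ℂ) = -(μ / 2) := by ring
      rw [e] at h'
      rcases hidx _ h' with h1 | h1
      · exact hμ2 (by simpa using neg_mem h1)
      · exact hμz' h1
  -- ### (3) apply (F) to `(W′, f, Λ′, c₀ = q, γ)`
  have hW'f : IsNewformOf W' f := hW₀.of_isIsogenous hiso.symm_of_charZero
  have hqC : (qz : ℂ) = (q : ℂ) := by rw [← hqz]; push_cast; rfl
  have hqz0 : qz ≠ 0 := by rintro rfl; apply hq; rw [← hqz]; rfl
  have hqΛ₁ : ∀ z ∈ periodLatticeGamma1 f, (qz : ℂ) * z ∈ L'.lattice := by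
    intro z hz; rw [hqC]; exact hhalf _ (hparΛ₁ z hz)
  have hμL'z : (qz : ℂ) * cuspSymbol f ⟨γ, hγ⟩ ∉ L'.lattice := by rw [hqC]; exact hμL'
  obtain ⟨x', y', hns', hx', hy', hred⟩ := hF W' f hW'f L' hL' qz hqz0 hqΛ₁ γ hγ hμL'z
  rw [hqC, ← hμdef] at hx' hy'
  -- `T̄ = (x′, y′)` is a 2-torsion point with `x′ = −e₀/2 − b₂(W′)/12`
  have h2μ : 2 * μ ∈ L'.lattice := h2L₀ μ hμL₀
  have hd0 : ℘'[L'] μ = 0 := L'.derivWeierstrassP_eq_zero_of_two_mul_mem h2μ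
  have h2y' : 2 * y' + W'.a₁ * x' + W'.a₃ = 0 := by
    have h : ((2 * y' + W'.a₁ * x' + W'.a₃ : ℚ) : ℂ) = 0 := by
      push_cast; rw [hy', hd0]; ring
    exact_mod_cast h
  have h℘'' : ℘[L''] (μ / 2) = -2 * ℘[L₀] (lam / 2) :=
    weierstrassP_velu_otherHalfPeriod L₀ L'' hz₀ h2z₀ hBc hBc0 h₂ h₃ hμL₀ hμ2 hμz
  have h℘L' : ℘[L'] μ = -(((q' : ℚ)) : ℂ) / 2 := by
    have hsc := PeriodPair.weierstrassP_mulLeft ((k : ℂ)⁻¹) (inv_ne_zero hkC) L' μ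
    rw [← hL''def] at hsc
    have hkμ : ℘[L''] ((k : ℂ)⁻¹ * μ) = ℘[L''] (μ / 2) := by
      rcases hk_sq with hk | hk
      · have hk' : (k : ℂ) = 2 := by exact_mod_cast hk
        rw [hk', inv_mul_eq_div]
      · have hk' : (k : ℂ) = -2 := by exact_mod_cast hk
        rw [hk', show (-2 : ℂ)⁻¹ * μ = -(μ / 2) by ring, L''.weierstrassP_neg]
    rw [hkμ, h℘'', he₀, inv_pow, inv_inv] at hsc
    have h4 : (k : ℂ) ^ 2 = 4 := hkC2
    rw [h4] at hsc
    linear_combination (-1 / 4 : ℂ) * hsc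
  have hx'val : x' = -q' / 2 - W'.b₂ / 12 := by
    have h : ((x' : ℚ) : ℂ) = ((-q' / 2 - W'.b₂ / 12 : ℚ) : ℂ) := by
      rw [hx', h℘L']; push_cast; ring
    exact_mod_cast h
  -- `4x′ ∈ ℤ`, so `ord_p x′ ≥ 0` at the odd prime `p`
  have hEq' : W'.toAffine.Equation x' y' := hns'.1
  have hx'int : 0 ≤ padicValRat p x' := by
    have hcub := PrimeConductorTwoTorsion.cubic_eq_zero W' hEq' h2y'
    have hb₂ : W'.b₂ = ((WeierstrassCurve.integralModelInt W').b₂ : ℚ) := by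
      conv_lhs => rw [← WeierstrassCurve.map_integralModelInt W']
      rw [WeierstrassCurve.map_b₂, eq_intCast]
    have hb₄ : W'.b₄ = ((WeierstrassCurve.integralModelInt W').b₄ : ℚ) := by
      conv_lhs => rw [← WeierstrassCurve.map_integralModelInt W']
      rw [WeierstrassCurve.map_b₄, eq_intCast]
    have hb₆ : W'.b₆ = ((WeierstrassCurve.integralModelInt W').b₆ : ℚ) := by
      conv_lhs => rw [← WeierstrassCurve.map_integralModelInt W']
      rw [WeierstrassCurve.map_b₆, eq_intCast]
    rw [hb₂, hb₄, hb₆] at hcub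
    obtain ⟨ζ, hζ⟩ := PrimeConductorTwoTorsion.exists_int_eq_of_cubic (WeierstrassCurve.integralModelInt W') hcub
    have hx'ζ : x' = (ζ : ℚ) / 4 := by rw [hζ]; ring
    by_cases hζ0 : ζ = 0
    · rw [hx'ζ, hζ0]; simp
    · rw [hx'ζ, padicValRat.div (by exact_mod_cast hζ0) (by norm_num), padicValRat.of_int]
      have h4 : padicValRat p (4 : ℚ) = 0 := by
        rw [show (4 : ℚ) = ((4 : ℕ) : ℚ) by norm_num, padicValRat.of_nat]
        have : padicValNat p 4 = 0 := by
          apply padicValNat.eq_zero_of_not_dvd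
          intro h
          have : p ∣ 2 ^ 2 := by simpa using h
          have := (Nat.prime_dvd_prime_iff_eq hp Nat.prime_two).mp (hp.dvd_of_dvd_pow this)
          exact hp2 this
        exact_mod_cast this
      rw [h4, sub_zero]
      exact_mod_cast Nat.zero_le _
  -- `Φ_x(T̄) = −D/256`
  have hΦ : W'.a₁ * y' - (3 * x' ^ 2 + 2 * W'.a₂ * x' + W'.a₄) = -D / 256 := by
    have hc4'' : ((W'.a₁ ^ 2 + 4 * W'.a₂) ^ 2 - 24 * (2 * W'.a₄ + W'.a₁ * W'.a₃)) * 16 =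
        720 * q' ^ 2 - 4 * (W₀.b₂ ^ 2 - 24 * W₀.b₄) := by
      have h := hc4'
      simp only [WeierstrassCurve.c₄, WeierstrassCurve.b₂, WeierstrassCurve.b₄] at h ⊢
      linear_combination 16 * h
    have hb₂' : W'.b₂ = W'.a₁ ^ 2 + 4 * W'.a₂ := rfl
    rw [hD, hx'val, hb₂', hq']
    rw [hx'val, hb₂', hq'] at h2y'
    rw [hq'] at hc4''
    linear_combination (W'.a₁ / 2) * h2y' + (1 / 768) * hc4''
  -- ### (4) read (F) at the odd prime `p`
  have hredp := hred p hp
  unfold WeierstrassCurve.HasNonsingularReductionAt at hredp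
  rw [WeierstrassCurve.Affine.evalEval_polynomialX, WeierstrassCurve.Affine.evalEval_polynomialY] at hredp
  rcases hredp with hneg | ⟨-, hΦunit⟩ | ⟨hY0, -⟩
  · exact absurd hneg (not_lt.mpr hx'int)
  · rw [hΦ, hDcast] at hΦunit
    intro hpD
    have hDz0 : (Dz : ℚ) ≠ 0 := by
      have : Dz ≠ 0 := by
        rintro h0
        have : (256 : ℤ) * (WeierstrassCurve.integralModelInt W₀).Δ = 0 := by rw [← hrel, h0]; ring
        rcases hΔodd with ⟨m, hm⟩
        omega
      exact_mod_cast this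
    rw [neg_div, padicValRat.neg, padicValRat.div hDz0 (by norm_num), padicValRat.of_int] at hΦunit
    have h256 : padicValRat p (256 : ℚ) = 0 := by
      rw [show (256 : ℚ) = ((256 : ℕ) : ℚ) by norm_num, padicValRat.of_nat]
      have : padicValNat p 256 = 0 := by
        apply padicValNat.eq_zero_of_not_dvd
        intro h
        have : p ∣ 2 ^ 8 := by simpa using h
        have := (Nat.prime_dvd_prime_iff_eq hp Nat.prime_two).mp (hp.dvd_of_dvd_pow this)
        exact hp2 this
      exact_mod_cast this
    rw [h256, sub_zero] at hΦunit
    have hv : padicValInt p Dz = 0 := by exact_mod_cast hΦunit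
    have hDz0' : Dz ≠ 0 := by exact_mod_cast hDz0
    rcases (padicValInt_dvd_iff 1 Dz).mp (by simpa using hpD) with h0 | h1
    · exact hDz0' h0
    · rw [hv] at h1; exact absurd h1 (by norm_num)
  · exact absurd h2y' hY0

end Summit.BirchSwinnertonDyer.BirchSwinnertonDyer.Theorems.DepletionAtTwo.SigmaNode

end
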